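import Summits.ResolutionOfSingularities.ResolutionOfSingularities.Theorems.ValuativeLuAlphaPTorsorAdaptedValueStepClaimC
import Summits.ResolutionOfSingularities.ResolutionOfSingularities.Theorems.ValuativeLuAlphaPTorsorAdaptedValueStepConstruct
import Summits.ResolutionOfSingularities.ResolutionOfSingularities.Theorems.ValuativeLuAlphaPTorsorAdaptedValueStepLevel
import HarnessLib

/-!
# Adapted value step, VI: the element `θ` of a level and the separation of its powers

Crux `Valuative.LuAlphaPTorsor` (stmt-ResolutionOfSingularities-0641), line `pfaff-line-log-final-forms`,
registered stub `stub_adaptedValueStep` (F6v, wave 2: the ADAPTED value step of the purely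
inseparable tower, any rank) — helper file 6/8.

`adValue_theta`: for a level `ℓ` of `y` with cut `ℓ₁` there is a Laurent monomial `θ` in the
`y_j` of level `< ℓ` (`θ = 1` if `p` divides the `t`-exponents of all low `y_j`, otherwise
`θ = y_(j₁)^σ` by Bezout, so that `t = θ · x^a · u^π`) such that every Laurent monomial `x^a t^b`
whose value is a low `y`-monomial is `θ^s x^E u^Q`, `s < p`, `E` supported below `ℓ₁`, the
powers `v(θ)^s`, `0 < s < p`, avoiding the values of `x`-monomials (`valueStep_kernel`).
`adValue_theta_separation`: hence a sum `∑ θ^s G_s`, `G_s ∈ R`, which is small below level `ℓ`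
has all `G_s` small (values of the `G_s` are monomial values by `adValue_claimC`, so the
non-small terms have pairwise distinct values). [folklore]
-/

noncomputable section

-- `Summit.<S>.<S>.…` duplicates the summit name by design (D-0017, single-problem summit).
set_option linter.dupNamespace false

open IsLocalRing

namespace Summit.ResolutionOfSingularities.ResolutionOfSingularities.Theorems.PfaffLine

open Literature.AlgebraicGeometry.Resolution

section Theta

variable {k K : Type} [Field k] [Field K] [Algebra k K] (O : ValuationSubring K) {n : ℕ}

/-- **The element `θ` of a level.** Setting of the value step (`t ^ p = x^α u`, `v(t) ∉ Λ`) with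
new parameters `y_j = x^{a_j} t^{b_j}`; fix a level `ℓ` of `y` and the corresponding cut `ℓ₁`
of `x` (hypothesis `hE`: an `x`-Laurent monomial whose value is a `y`-monomial of the levels
`< ℓ` lives on the levels `< ℓ₁`). Then there is a Laurent monomial `θ` in the `y_j` of level
`< ℓ` such that every Laurent monomial `x^a t^b` whose value is a `y`-monomial of the levels
`< ℓ` is `θ^s · x^E · u^Q` with `s < p`, `E` supported on the levels `< ℓ₁`, and, as soon as
some `s ≠ 0` occurs, the powers `v(θ)^{s'}`, `0 < s' < p`, are not values of `x`-monomials. -/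
theorem adValue_theta {p : ℕ} (hp : p.Prime) (x : Fin n → K) (hx0 : ∀ i, x i ≠ 0)
    (hind : ∀ m : Fin n → ℤ, (∏ i, O.valuation (x i) ^ (m i)) = 1 → m = 0)
    (lv : Fin n → ℕ) (t u : K) (α : Fin n → ℕ) (hvu : O.valuation u = 1)
    (htp : t ^ p = (∏ i, x i ^ (α i)) * u)
    (hvt : ∀ m : Fin n → ℤ, O.valuation t ≠ ∏ i, O.valuation (x i) ^ (m i))
    (y : Fin n → K) (lv' : Fin n → ℕ) (hy0 : ∀ j, y j ≠ 0)
    (af : Fin n → Fin n → ℤ) (bf : Fin n → ℤ)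
    (hyab : ∀ j, y j = (∏ i, x i ^ (af j i)) * t ^ (bf j)) (ℓ ℓ₁ : ℕ)
    (hE : ∀ m : Fin n → ℤ, (∃ μ : Fin n → ℤ, (∀ j, ℓ ≤ lv' j → μ j = 0) ∧
      (∏ i, O.valuation (x i) ^ (m i)) = ∏ j, O.valuation (y j) ^ (μ j)) →
      ∀ i, ℓ₁ ≤ lv i → m i = 0) :
    ∃ (θ : K) (ν₁ : Fin n → ℤ), (∀ j, ℓ ≤ lv' j → ν₁ j = 0) ∧ θ = ∏ j, y j ^ (ν₁ j) ∧ θ ≠ 0 ∧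
      ∀ (a : Fin n → ℤ) (b : ℤ), (∃ μ : Fin n → ℤ, (∀ j, ℓ ≤ lv' j → μ j = 0) ∧
        O.valuation ((∏ i, x i ^ (a i)) * t ^ b) = ∏ j, O.valuation (y j) ^ (μ j)) →
      ∃ (s : ℕ) (E : Fin n → ℤ) (Q : ℤ), s < p ∧ (∀ i, ℓ₁ ≤ lv i → E i = 0) ∧
        (∏ i, x i ^ (a i)) * t ^ b = θ ^ s * (∏ i, x i ^ (E i)) * u ^ Q ∧
        (s ≠ 0 → ∀ (s' : ℕ) (m : Fin n → ℤ), 0 < s' → s' < p →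
          O.valuation θ ^ s' ≠ ∏ i, O.valuation (x i) ^ (m i)) := by
  classical
  -- ### non-vanishing, values, the relation in `ℤ`-exponents
  have hp0 : p ≠ 0 := hp.ne_zero
  have hu0 : u ≠ 0 := fun h => zero_ne_one (by rw [← hvu, h, map_zero])
  have ht0 : t ≠ 0 := adValue_t_ne_zero O hp0 x hx0 t u α hvu htp
  have hvx0 : ∀ i, O.valuation (x i) ≠ 0 := fun i => (map_ne_zero _).mpr (hx0 i)
  have hvy0 : ∀ j, O.valuation (y j) ≠ 0 := fun j => (map_ne_zero _).mpr (hy0 j)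
  have hvt0 : O.valuation t ≠ 0 := (map_ne_zero _).mpr ht0
  have hvmono : ∀ c : Fin n → ℤ,
      O.valuation (∏ i, x i ^ (c i)) = ∏ i, O.valuation (x i) ^ (c i) := fun c =>
    valuation_prod_zpow x O c
  have hvtp : O.valuation t ^ p = ∏ i, O.valuation (x i) ^ (α i) := by
    rw [← map_pow, htp, map_mul, hvu, mul_one, map_prod]
    exact Finset.prod_congr rfl fun i _ => map_pow _ _ _
  let α' : Fin n → ℤ := fun i => (α i : ℤ)
  have hxα : (∏ i, x i ^ (α i)) = ∏ i, x i ^ (α' i) :=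
    Finset.prod_congr rfl fun i _ => (zpow_natCast _ _).symm
  have htp' : t ^ (p : ℤ) = (∏ i, x i ^ (α' i)) * u := by rw [zpow_natCast, htp, hxα]
  -- kernel: `X^a · v(t)^s = 1`, `s < p` ⇒ `s = 0`
  have hker : ∀ (a : Fin n → ℤ) (s : ℕ), s < p →
      (∏ i, O.valuation (x i) ^ (a i)) * O.valuation t ^ s = 1 → s = 0 := fun a s hs h =>
    (valueStep_kernel hp (fun i => O.valuation (x i)) hvx0 hind (O.valuation t) hvt0 α hvtp hvt
      a s hs h).1
  -- `t^b = x^{qα} u^q t^s`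
  have htb : ∀ b : ℤ, ∃ (q : ℤ) (s : ℕ), s < p ∧
      t ^ b = (∏ i, x i ^ ((q • α') i)) * u ^ q * t ^ s := by
    intro b
    obtain ⟨q, s, hs, hb⟩ := adValue_ediv p hp0 b
    refine ⟨q, s, hs, ?_⟩
    rw [hb, zpow_add₀ ht0, zpow_mul, htp', zpow_natCast, mul_zpow, prod_zpow_smul_eq]
  by_cases hcase : ∀ j, lv' j < ℓ → (p : ℤ) ∣ bf j
  · -- ### Case I: the low `y`-monomials are `x`-monomials up to units
    refine ⟨1, 0, fun _ _ => rfl, by simp, one_ne_zero, ?_⟩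
    rintro a b ⟨μ, hμ, hval⟩
    obtain ⟨q, s, hs, htbs⟩ := htb b
    -- the value of `y^μ` is the value of an `x`-monomial
    have hyval : ∀ j, μ j ≠ 0 → O.valuation (y j) =
        ∏ i, O.valuation (x i) ^ ((af j + (bf j / p) • α') i) := by
      intro j hj
      have hjℓ : lv' j < ℓ := by
        by_contra h
        exact hj (hμ j (not_lt.mp h))
      obtain ⟨d, hd⟩ := hcase j hjℓ
      have hdp : bf j / p = d := by
        rw [hd, Int.mul_ediv_cancel_left _ (by exact_mod_cast hp0 : (p : ℤ) ≠ 0)]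
      have htbj : t ^ (bf j) = (t ^ (p : ℤ)) ^ d := by rw [← zpow_mul, ← hd]
      rw [hdp, hyab j, htbj, htp', mul_zpow, ← prod_zpow_smul_eq, map_mul, map_mul,
        map_zpow₀ _ u, hvu, one_zpow, mul_one, ← map_mul, ← prod_zpow_add_eq x hx0, hvmono]
    have hYX : (∏ j, O.valuation (y j) ^ (μ j)) =
        ∏ i, O.valuation (x i) ^ ((∑ j, μ j • (af j + (bf j / p) • α')) i) := by
      rw [adValue_prod_zpow_finsum _ hvx0]
      refine Finset.prod_congr rfl fun j _ => ?_
      by_cases hj : μ j = 0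
      · rw [hj, zpow_zero]
        exact (Finset.prod_eq_one fun i _ => by simp).symm
      · rw [prod_zpow_smul_eq, hyval j hj]
    -- `s = 0`
    have hs0 : s = 0 := by
      refine hker (a + q • α' - ∑ j, μ j • (af j + (bf j / p) • α')) s hs ?_
      have h1 : O.valuation ((∏ i, x i ^ (a i)) * t ^ b) =
          (∏ i, O.valuation (x i) ^ ((a + q • α') i)) * O.valuation t ^ s := by
        rw [htbs, map_mul, map_mul, map_mul, map_pow, map_zpow₀ _ u, hvu, one_zpow, mul_one,
          hvmono, hvmono, ← mul_assoc, ← prod_zpow_add_eq _ hvx0]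
      rw [adValue_prod_zpow_sub _ hvx0, ← hYX, ← hval, h1, mul_right_comm,
        mul_inv_cancel₀]
      rw [← h1, hval]
      exact adValue_prod_zpow_ne_zero _ hvy0 μ
    refine ⟨0, a + q • α', q, hp.pos, ?_, ?_, fun h => (h rfl).elim⟩
    · refine hE _ ⟨μ, hμ, ?_⟩
      rw [← hval, htbs, hs0, pow_zero, mul_one, map_mul, map_mul, map_zpow₀ _ u, hvu, one_zpow,
        mul_one, ← map_mul, ← prod_zpow_add_eq x hx0, hvmono]
    · rw [htbs, hs0, pow_zero, mul_one, pow_zero, one_mul, ← mul_assoc, ← prod_zpow_add_eq x hx0]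
  · -- ### Case II: a low `y_{j₁}` with `p ∤ b_{j₁}`; Bezout
    push Not at hcase
    obtain ⟨j₁, hj₁, hndvd⟩ := hcase
    have hcop : IsCoprime (bf j₁) (p : ℤ) := by
      rw [Int.isCoprime_iff_gcd_eq_one, Int.gcd_comm]
      have : Nat.Coprime p (bf j₁).natAbs :=
        (Nat.Prime.coprime_iff_not_dvd hp).mpr fun h => hndvd (Int.natCast_dvd.mpr h)
      exact this
    obtain ⟨σ, π, hσπ⟩ := hcop
    -- `θ := y_{j₁}^σ`
    refine ⟨y j₁ ^ σ, Pi.single j₁ σ, fun j hj => ?_, ?_, zpow_ne_zero _ (hy0 j₁), ?_⟩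
    · rw [Pi.single_eq_of_ne]
      rintro rfl
      exact absurd hj₁ (not_lt.mpr hj)
    · rw [Finset.prod_eq_single j₁ (fun j _ hj => by rw [Pi.single_eq_of_ne hj, zpow_zero])
        (fun h => absurd (Finset.mem_univ j₁) h), Pi.single_eq_same]
    -- `t = θ · x^{at} · u^π`
    set at' : Fin n → ℤ := π • α' - σ • af j₁ with hat
    have hxa0 : ∀ v : Fin n → ℤ, (∏ i, x i ^ (v i)) ≠ 0 := fun v => prod_zpow_ne_zero x hx0 v
    have htbf : t ^ (bf j₁) = y j₁ * (∏ i, x i ^ (af j₁ i))⁻¹ := by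
      rw [hyab j₁, mul_comm, inv_mul_cancel_left₀ (hxa0 _)]
    have hteq : t = y j₁ ^ σ * (∏ i, x i ^ (at' i)) * u ^ π := by
      have h1 : t = t ^ (σ * bf j₁ + π * p) := by rw [hσπ, zpow_one]
      rw [h1, zpow_add₀ ht0, mul_comm σ, zpow_mul, htbf, mul_comm π, zpow_mul, htp', mul_zpow,
        mul_zpow, inv_zpow, hat, adValue_prod_zpow_sub x hx0, prod_zpow_smul_eq,
        prod_zpow_smul_eq]
      ring
    -- `θ^p = x^{…} u^{…}`
    have hθp : (y j₁ ^ σ) ^ (p : ℤ) =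
        (∏ i, x i ^ (((σ * p) • af j₁ + (σ * bf j₁) • α') i)) * u ^ (σ * bf j₁) := by
      have ht1 : (t ^ bf j₁) ^ (σ * (p : ℤ)) = (t ^ (p : ℤ)) ^ (σ * bf j₁) := by
        rw [← zpow_mul, ← zpow_mul]
        congr 1
        ring
      rw [← zpow_mul, hyab j₁, mul_zpow, ht1, htp', mul_zpow, ← prod_zpow_smul_eq,
        ← prod_zpow_smul_eq, prod_zpow_add_eq x hx0]
      ring
    have hvθ : O.valuation (y j₁ ^ σ) = O.valuation t * (∏ i, O.valuation (x i) ^ (at' i))⁻¹ := by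
      have h := congrArg O.valuation hteq
      rw [map_mul, map_mul, map_zpow₀ _ u, hvu, one_zpow, mul_one, hvmono] at h
      rw [h, mul_inv_cancel_right₀ (adValue_prod_zpow_ne_zero _ hvx0 _)]
    rintro a b ⟨μ, hμ, hval⟩
    obtain ⟨q, s, hs, hbqs⟩ := adValue_ediv p hp0 b
    -- the decomposition
    set E : Fin n → ℤ := a + b • at' + q • ((σ * p) • af j₁ + (σ * bf j₁) • α') with hEdef
    set Q : ℤ := π * b + (σ * bf j₁) * q with hQdef
    have hΘ0 : y j₁ ^ σ ≠ 0 := zpow_ne_zero _ (hy0 j₁)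
    have hΘb : (y j₁ ^ σ) ^ b = (y j₁ ^ σ) ^ s * ((y j₁ ^ σ) ^ (p : ℤ)) ^ q := by
      rw [hbqs, zpow_add₀ hΘ0, zpow_mul, zpow_natCast (y j₁ ^ σ) s, mul_comm]
    have hXE : (∏ i, x i ^ (E i)) = (∏ i, x i ^ (a i)) * (∏ i, x i ^ (at' i)) ^ b *
        (∏ i, x i ^ (((σ * p) • af j₁ + (σ * bf j₁) • α') i)) ^ q := by
      rw [hEdef, prod_zpow_add_eq x hx0, prod_zpow_add_eq x hx0, prod_zpow_smul_eq,
        prod_zpow_smul_eq]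
    have hUQ : u ^ Q = (u ^ π) ^ b * (u ^ (σ * bf j₁)) ^ q := by
      rw [hQdef, zpow_add₀ hu0, zpow_mul, zpow_mul]
    have hdec : (∏ i, x i ^ (a i)) * t ^ b = (y j₁ ^ σ) ^ s * (∏ i, x i ^ (E i)) * u ^ Q := by
      rw [hXE, hUQ, hteq, mul_zpow, mul_zpow, hΘb, hθp, mul_zpow]
      ring
    refine ⟨s, E, Q, hs, ?_, hdec, ?_⟩
    · -- `E` lives below `ℓ₁`
      refine hE E ⟨μ - (s : ℤ) • Pi.single j₁ σ, fun j hj => ?_, ?_⟩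
      · rw [Pi.sub_apply, Pi.smul_apply, hμ j hj, Pi.single_eq_of_ne (by
          rintro rfl; exact absurd hj₁ (not_lt.mpr hj)), smul_zero, sub_zero]
      · have hθval : O.valuation (y j₁ ^ σ) = ∏ j, O.valuation (y j) ^ ((Pi.single j₁ σ : Fin n → ℤ) j) := by
          rw [Finset.prod_eq_single j₁ (fun j _ hj => by rw [Pi.single_eq_of_ne hj, zpow_zero])
            (fun h => absurd (Finset.mem_univ j₁) h), Pi.single_eq_same, map_zpow₀]
        have h2 : O.valuation ((∏ i, x i ^ (a i)) * t ^ b) =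
            O.valuation (y j₁ ^ σ) ^ s * ∏ i, O.valuation (x i) ^ (E i) := by
          rw [hdec, map_mul, map_mul, map_pow, map_zpow₀ _ u, hvu, one_zpow, mul_one, hvmono]
        rw [adValue_prod_zpow_sub _ hvy0, prod_zpow_smul_eq, ← hθval, ← hval, h2, zpow_natCast,
          mul_comm, inv_mul_cancel_left₀ (pow_ne_zero _ ((map_ne_zero _).mpr
            (zpow_ne_zero _ (hy0 j₁))))]
    · -- separation
      intro _ s' m hs'0 hs'p heq
      rw [hvθ, mul_pow, ← zpow_natCast, ← zpow_natCast, inv_zpow,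
        ← prod_zpow_smul_eq, mul_inv_eq_iff_eq_mul₀ (adValue_prod_zpow_ne_zero _ hvx0 _),
        ← prod_zpow_add_eq _ hvx0] at heq
      have h := hker (-(m + (s' : ℤ) • at')) s' hs'p (by
        rw [prod_zpow_neg_eq, ← heq, zpow_natCast, inv_mul_cancel₀ (pow_ne_zero _ hvt0)])
      omega


/-- **Separation of the powers of `θ`.** With the data of a level `ℓ` of `y` (cut `ℓ₁`, element
`θ`, a Laurent monomial in the `y_j` of level `< ℓ`): if `G₀, …, G_{p-1} ∈ R` are such that
`∑ θ^s G_s` is smaller than every `y`-monomial of the levels `< ℓ`, and the powers `v(θ)^{s'}`,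
`0 < s' < p`, are not values of `x`-monomials as soon as some `G_s`, `s ≠ 0`, is not small, then
every `G_s` is small: otherwise the values of the non-small terms are pairwise distinct low
`y`-monomials (the values of the `G_s` are `x`-monomial values by `adValue_claimC`) and the
dominant one is the value of the sum. -/
theorem adValue_theta_separation {p : ℕ} (R : Subalgebra k K) (hRO : R.toSubring ≤ O.toSubring)
    (x : Fin n → K) (hx : ∀ i, x i ∈ R) (lv : Fin n → ℕ) (hx0 : ∀ i, x i ≠ 0)
    (hind : ∀ m : Fin n → ℤ, (∏ i, O.valuation (x i) ^ (m i)) = 1 → m = 0)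
    (hC2a : ∀ i i', lv i < lv i' → ∀ m : Fin n → ℤ, (∀ j, lv i < lv j → m j = 0) →
      O.valuation (x i') < ∏ j, O.valuation (x j) ^ (m j))
    (hLA : LevelArchimedean (fun i => O.valuation (x i)) lv)
    (hC3 : ∀ (ℓ : ℕ) (z : R.toSubring),
      z ∈ Ideal.span (Set.range fun i : {i : Fin n // ℓ ≤ lv i} => (⟨x i.1, hx i.1⟩ : R.toSubring)) ↔
        ∀ m : Fin n → ℤ, (∀ j, ℓ ≤ lv j → m j = 0) →
          O.valuation (z : K) < ∏ j, O.valuation (x j) ^ (m j))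
    (y : Fin n → K) (lv' : Fin n → ℕ) (hy0 : ∀ j, y j ≠ 0) (hvy1 : ∀ j, O.valuation (y j) < 1)
    (hC2a' : ∀ i i', lv' i < lv' i' → ∀ m : Fin n → ℤ, (∀ j, lv' i < lv' j → m j = 0) →
      O.valuation (y i') < ∏ j, O.valuation (y j) ^ (m j))
    (c : Fin n → Fin n → ℕ) (w : Fin n → K) (hw : ∀ i, w i ∈ R) (hwi : ∀ i, (w i)⁻¹ ∈ R)
    (hxw : ∀ i, x i = (∏ j, y j ^ (c i j)) * w i) (ℓ ℓ₁ : ℕ)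
    (hℓ₁ : ∀ i, (∃ h, ℓ ≤ lv' h ∧ c i h ≠ 0) ↔ ℓ₁ ≤ lv i)
    (θ : K) (ν₁ : Fin n → ℤ) (hν₁ : ∀ j, ℓ ≤ lv' j → ν₁ j = 0) (hθν : θ = ∏ j, y j ^ (ν₁ j))
    (hθ0 : θ ≠ 0) (G : ℕ → K) (hGR : ∀ s, G s ∈ R)
    (hsep : ∀ s ∈ Finset.range p, (¬ ∀ m : Fin n → ℤ, (∀ j, ℓ ≤ lv' j → m j = 0) →
        O.valuation (G s) < ∏ j, O.valuation (y j) ^ (m j)) → s ≠ 0 →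
      ∀ (s' : ℕ) (m : Fin n → ℤ), 0 < s' → s' < p →
        O.valuation θ ^ s' ≠ ∏ i, O.valuation (x i) ^ (m i))
    (htotsmall : ∀ m : Fin n → ℤ, (∀ j, ℓ ≤ lv' j → m j = 0) →
      O.valuation (∑ s ∈ Finset.range p, θ ^ s * G s) < ∏ j, O.valuation (y j) ^ (m j)) :
    ∀ s ∈ Finset.range p, ∀ m : Fin n → ℤ, (∀ j, ℓ ≤ lv' j → m j = 0) →
      O.valuation (G s) < ∏ j, O.valuation (y j) ^ (m j) := by
  classical
  have hvy0 : ∀ j, O.valuation (y j) ≠ 0 := fun j => (map_ne_zero _).mpr (hy0 j)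
  have hvx0 : ∀ i, O.valuation (x i) ≠ 0 := fun i => (map_ne_zero _).mpr (hx0 i)
  have hY0 := adValue_prod_zpow_ne_zero (fun j => O.valuation (y j)) hvy0
  have small_mono : ∀ (z θ' : K) (ν : Fin n → ℤ), (∀ j, ℓ ≤ lv' j → ν j = 0) →
      O.valuation θ' = ∏ j, O.valuation (y j) ^ (ν j) →
      (∀ m : Fin n → ℤ, (∀ j, ℓ ≤ lv' j → m j = 0) →
        O.valuation z < ∏ j, O.valuation (y j) ^ (m j)) →
      ∀ m : Fin n → ℤ, (∀ j, ℓ ≤ lv' j → m j = 0) →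
        O.valuation (θ' * z) < ∏ j, O.valuation (y j) ^ (m j) := by
    intro z θ' ν hν hθ' hz m hm
    rw [map_mul, hθ']
    have h := hz (m - ν) fun j hj => by rw [Pi.sub_apply, hm j hj, hν j hj, sub_zero]
    rw [adValue_prod_zpow_sub _ hvy0, lt_mul_inv_iff₀ (zero_lt_iff.mpr (hY0 ν)), mul_comm] at h
    exact h
  have hXlow : ∀ m : Fin n → ℤ, (∀ i, ℓ₁ ≤ lv i → m i = 0) →
      ∃ κ : Fin n → ℤ, (∀ j, ℓ ≤ lv' j → κ j = 0) ∧
        (∏ i, O.valuation (x i) ^ (m i)) = ∏ j, O.valuation (y j) ^ (κ j) := by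
    intro m hm
    refine ⟨_, fun j hj => ?_, adValue_vxmono O R hRO x hx0 y hy0 c w hw hwi hxw m⟩
    simp only [Finset.sum_apply, Pi.smul_apply, smul_eq_mul]
    refine Finset.sum_eq_zero fun i _ => ?_
    by_cases hi : ℓ₁ ≤ lv i
    · rw [hm i hi, zero_mul]
    · have hci : c i j = 0 := by
        by_contra hc
        exact hi ((hℓ₁ i).mp ⟨j, hj, hc⟩)
      rw [hci, Nat.cast_zero, mul_zero]
  have hvθs : ∀ s : ℕ, O.valuation (θ ^ s) = ∏ j, O.valuation (y j) ^ (((s : ℤ) • ν₁) j) := by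
    intro s
    rw [prod_zpow_smul_eq, zpow_natCast, map_pow, hθν, valuation_prod_zpow y O]
  have hsν₁ : ∀ s : ℕ, ∀ j, ℓ ≤ lv' j → ((s : ℤ) • ν₁) j = 0 := fun s j hj => by
    rw [Pi.smul_apply, smul_eq_mul, hν₁ j hj, mul_zero]
  by_contra hcon
  push Not at hcon
  set Sbad := (Finset.range p).filter fun s => ¬ ∀ m : Fin n → ℤ, (∀ j, ℓ ≤ lv' j → m j = 0) →
    O.valuation (G s) < ∏ j, O.valuation (y j) ^ (m j) with hSbad
  have hSne2 : Sbad.Nonempty := by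
    obtain ⟨s, hs, m, hm, hle⟩ := hcon
    exact ⟨s, Finset.mem_filter.mpr ⟨hs, fun h => absurd (h m hm) (not_lt.mpr hle)⟩⟩
  -- the bad part is small
  set Z' := ∑ s ∈ Sbad, θ ^ s * G s with hZ'
  have hZ'small : ∀ m : Fin n → ℤ, (∀ j, ℓ ≤ lv' j → m j = 0) →
      O.valuation Z' < ∏ j, O.valuation (y j) ^ (m j) := by
    intro m hm
    have heq : Z' = (∑ s ∈ Finset.range p, θ ^ s * G s) +
        -(∑ s ∈ (Finset.range p).filter (fun s => ∀ m : Fin n → ℤ,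
          (∀ j, ℓ ≤ lv' j → m j = 0) → O.valuation (G s) < ∏ j, O.valuation (y j) ^ (m j)),
          θ ^ s * G s) := by
      rw [hZ', hSbad, ← Finset.sum_filter_add_sum_filter_not (Finset.range p) (fun s =>
        ∀ m : Fin n → ℤ, (∀ j, ℓ ≤ lv' j → m j = 0) →
          O.valuation (G s) < ∏ j, O.valuation (y j) ^ (m j))]
      ring
    rw [heq]
    refine Valuation.map_add_lt _ (htotsmall m hm) ?_
    rw [Valuation.map_neg]
    refine adValue_small_sum O y lv' hy0 _ _ ℓ (fun s hs => ?_) m hm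
    exact small_mono _ _ _ (hsν₁ s) (hvθs s) (Finset.mem_filter.mp hs).2
  -- values of the bad terms are low `y`-monomials …
  have hbad : ∀ s, ∃ κ : Fin n → ℤ, ∃ ms : Fin n → ℕ, s ∈ Sbad →
      (∀ j, ℓ ≤ lv' j → κ j = 0) ∧ (∀ i, ℓ₁ ≤ lv i → ms i = 0) ∧
      O.valuation (G s) = ∏ i, O.valuation (x i) ^ (ms i) ∧
      O.valuation (θ ^ s * G s) = ∏ j, O.valuation (y j) ^ (κ j) := by
    intro s
    by_cases hs : s ∈ Sbad
    swap
    · exact ⟨0, 0, fun h => (hs h).elim⟩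
    have hnot := (Finset.mem_filter.mp hs).2
    have hnotmem : (⟨G s, hGR s⟩ : R.toSubring) ∉ Ideal.span (Set.range
        fun i : {i : Fin n // ℓ₁ ≤ lv i} => (⟨x i.1, hx i.1⟩ : R.toSubring)) := fun h =>
      hnot ((adValue_smallY_iff_mem O R hRO x hx lv hx0 hC3 y lv' hy0 hvy1 hC2a' c w hw hwi hxw
        ℓ ℓ₁ hℓ₁ (hGR s)).mpr h)
    rw [hC3 ℓ₁] at hnotmem
    push Not at hnotmem
    obtain ⟨m, hm, hle⟩ := hnotmem
    obtain ⟨ms, hms, hvG⟩ := adValue_claimC O R hRO x hx lv hx0 hC2a hC3 hind hLA ℓ₁ (G s)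
      (hGR s) ⟨m, hm, hle⟩
    obtain ⟨κ₀, hκ₀, hκ₀eq⟩ := hXlow (fun i => (ms i : ℤ)) fun i hi => by
      rw [hms i hi, Nat.cast_zero]
    refine ⟨(s : ℤ) • ν₁ + κ₀, ms, fun _ => ⟨fun j hj => ?_, hms, hvG, ?_⟩⟩
    · rw [Pi.add_apply, hsν₁ s j hj, hκ₀ j hj, add_zero]
    · rw [map_mul, hvθs, hvG, prod_zpow_add_eq _ hvy0, ← hκ₀eq]
      congr 1
  choose κ ms hbad using hbad
  -- … and pairwise distinct
  have hdist_lt : ∀ s ∈ Sbad, ∀ s' ∈ Sbad, s' < s →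
      O.valuation (θ ^ s * G s) ≠ O.valuation (θ ^ s' * G s') := by
    intro s hs s' hs' hlt heq
    have hsp : s < p := Finset.mem_range.mp (Finset.mem_filter.mp hs).1
    rw [map_mul, map_mul, map_pow, map_pow, (hbad s hs).2.2.1, (hbad s' hs').2.2.1] at heq
    -- `v(θ)^(s - s') = X^{ms' - ms}`
    have hθ0' : O.valuation θ ≠ 0 := (map_ne_zero _).mpr hθ0
    have h1 : O.valuation θ ^ (s - s') = ∏ i, O.valuation (x i) ^
        ((fun i => (ms s' i : ℤ)) - fun i => (ms s i : ℤ)) i := by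
      rw [adValue_prod_zpow_sub _ hvx0, eq_mul_inv_iff_mul_eq₀ (adValue_prod_zpow_ne_zero _ hvx0 _)]
      have e1 : (∏ i, O.valuation (x i) ^ ((fun i => (ms s i : ℤ)) i)) =
          ∏ i, O.valuation (x i) ^ (ms s i) :=
        Finset.prod_congr rfl fun i _ => zpow_natCast _ _
      have e2 : (∏ i, O.valuation (x i) ^ ((fun i => (ms s' i : ℤ)) i)) =
          ∏ i, O.valuation (x i) ^ (ms s' i) :=
        Finset.prod_congr rfl fun i _ => zpow_natCast _ _
      rw [e1, e2]
      have h3 : O.valuation θ ^ s = O.valuation θ ^ (s - s') * O.valuation θ ^ s' := by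
        rw [← pow_add, Nat.sub_add_cancel hlt.le]
      rw [h3, mul_assoc, mul_comm (O.valuation θ ^ s')] at heq
      exact mul_left_cancel₀ (pow_ne_zero _ hθ0') (by rw [← heq]; ac_rfl)
    exact hsep s (Finset.mem_filter.mp hs).1 (Finset.mem_filter.mp hs).2 (by omega) (s - s') _
      (Nat.sub_pos_of_lt hlt) (by omega) h1
  have hdist : ∀ s ∈ Sbad, ∀ s' ∈ Sbad, s ≠ s' →
      O.valuation (θ ^ s * G s) ≠ O.valuation (θ ^ s' * G s') := by
    intro s hs s' hs' hne
    rcases lt_or_gt_of_ne hne with h | h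
    · exact fun heq => hdist_lt s' hs' s hs h heq.symm
    · exact hdist_lt s hs s' hs' h
  -- the dominant bad term
  obtain ⟨s₀, hs₀, hmax⟩ := Finset.exists_max_image Sbad (fun s => O.valuation (θ ^ s * G s)) hSne2
  have hvZ' : O.valuation Z' = O.valuation (θ ^ s₀ * G s₀) := by
    refine Valuation.map_sum_eq_of_lt _ hs₀ fun s hs => ?_
    rw [Finset.mem_sdiff, Finset.mem_singleton] at hs
    exact lt_of_le_of_ne (hmax s hs.1) (hdist s hs.1 s₀ hs₀ hs.2)
  have h := hZ'small (κ s₀) (hbad s₀ hs₀).1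
  rw [hvZ', (hbad s₀ hs₀).2.2.2] at h
  exact lt_irrefl _ h

end Theta

/-- Registered anchor of this helper file: Euclidean division of an integer exponent by `p`. -/
theorem adValue_anchor_theta : ∀ (p : ℕ), p ≠ 0 → ∀ b : ℤ, ∃ (q : ℤ) (s : ℕ), s < p ∧ b = p * q + s := by
  intro p hp b
  exact adValue_ediv p hp b

end Summit.ResolutionOfSingularities.ResolutionOfSingularities.Theorems.PfaffLine

end
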